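import Mathlib
import Summits.ValiantsHypothesis.ValiantsHypothesis.Theorems.MonotoneRestorationOrbitRestorationQPHereditaryTerms
import HarnessLib

/-!
# Value derivations (symmetrisation in ORBIT currency, I)

Route MonotoneRestoration, crux `OrbitRestorationQP` (stmt-ValiantsHypothesis-18293), namespace
`Summit.ValiantsHypothesis.ValiantsHypothesis.Theorems` (sub-namespaces `StepData`, `ValueDerivation`).

THE VALUE-ORBIT SYMMETRISATION THEOREM (this file and its sequels `…OrbitRestorationQPValueTerms.lean`,
`…OrbitRestorationQPValueTermsAction.lean`, `…OrbitRestorationQPValueOrbit.lean`).  Let a finite group `Γ`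
act on the variables `X` and let `f ∈ K[X]` (`K` a field of characteristic `0`) be `Γ`-invariant.  Suppose
`f` has a VALUE DERIVATION — an ordinary (non-symmetric) straight-line computation of any length: a finite
set `S ∋ f` of polynomials with a rank, every member being a variable, a constant, a weighted sum (any
fan-in) or a binary product of members of smaller rank — all of whose VALUES `q ∈ S` have `Γ`-orbits
`|Γ • q| ≤ B`.  Then `f` has a `Γ`-SYMMETRIC Dawar–Wilsenach circuit whose orbit size `ORB` (largest orbit
of a gate under ALL automorphisms, §3.3) is `≤ B²` — whatever the length of the derivation.  So in orbit
currency symmetry is free: only the orbits of the intermediate VALUES of some computation of `f` matter.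

Mechanism (this file: the data).  Close `S` under `Γ` (`U = Γ • S`, rank `rU q` = least rank of a
witness `(γ, p)`, `p ∈ S`, `γ • p = q`); the sequel attaches to every `q ∈ U` a CANONICAL normal
hereditary term by AVERAGING the one-step unfoldings of ALL least-rank witnesses of `q` (`W q`), which
makes the term assignment `Γ`-equivariant, so that the reduced term circuit of the K3 engine
(`TermCircuit.exists_symmetric_orbitSize_le`, `…TermCircuitOrbit.lean`: reduced ⇒ rigid ⇒ `ORB` = designed
orbit) applies.

* `ren γ` — the renaming action of `Γ` on `K[X]` (an algebra hom); `StepData`, `StepData.Valid`,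
  `ValueDerivation` — value derivations; `StepData.map` — transport of a step along `γ`
  (`value_map`, `args_map`, `map_mul`);
* `ValueDerivation.U`, `rU`, `W` (least-rank witnesses: `exists_witness`, `W_ren`, `card_W_ren`),
  `stepOf` (`value_step_W`, `args_step_W`: operands of least witnesses lie in `U` with smaller `rU`).

Everything is proved. [folklore]

## References
* A. Dawar, G. Wilsenach, *Symmetric arithmetic circuits*, ToC 21 (2025), Defs. 2.2, 3.6, 3.7, §3.3
  (`Orb`, `ORB`, rigid circuits). [DawarWilsenach2025]
* M. Anderson, A. Dawar, *On symmetric circuits and fixed-point logics*, Theory Comput. Syst. 60 (2017),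
  §3–4 (rigid circuits, supports). [AndersonDawar2016]
-/

noncomputable section

open scoped Classical

-- `Summit.ValiantsHypothesis.ValiantsHypothesis.…` is the tree's single-conjunct layout (Sub = Summit).
set_option linter.dupNamespace false

namespace Summit.ValiantsHypothesis.ValiantsHypothesis.Theorems

open HTerm

universe u v w

/-! ### The renaming action on polynomials -/

section Ren

variable {K : Type u} {X : Type v} [CommSemiring K] {Γ : Type w} [Group Γ] [MulAction Γ X]

/-- The action of a symmetry `γ` of the variables on polynomials: rename `x ↦ γ • x` (a `K`-algebra
homomorphism). [folklore] -/
def ren (γ : Γ) : MvPolynomial X K →ₐ[K] MvPolynomial X K := MvPolynomial.rename fun x : X => γ • x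

/-- `ren γ` on a variable. [folklore] -/
@[simp] theorem ren_X (γ : Γ) (x : X) : ren (K := K) γ (MvPolynomial.X x) = MvPolynomial.X (γ • x) := by
  simp [ren]

/-- `ren γ` on a constant. [folklore] -/
@[simp] theorem ren_C (γ : Γ) (c : K) : ren (X := X) γ (MvPolynomial.C c) = MvPolynomial.C c := by
  simp [ren]

/-- `ren 1 = id`. [folklore] -/
@[simp] theorem ren_one (p : MvPolynomial X K) : ren (1 : Γ) p = p := by
  have h : (fun x : X => (1 : Γ) • x) = id := funext fun x => one_smul Γ x
  simp only [ren, h]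
  exact MvPolynomial.rename_id (σ := X) (R := K) ▸ rfl

/-- `ren (γ * δ) = ren γ ∘ ren δ`. [folklore] -/
theorem ren_mul (γ δ : Γ) (p : MvPolynomial X K) : ren (γ * δ) p = ren γ (ren δ p) := by
  have h : (fun x : X => (γ * δ) • x) = (fun x : X => γ • x) ∘ fun x : X => δ • x :=
    funext fun x => mul_smul γ δ x
  show MvPolynomial.rename _ p = MvPolynomial.rename _ (MvPolynomial.rename _ p)
  rw [MvPolynomial.rename_rename, h]

/-- `ren γ⁻¹` undoes `ren γ`. [folklore] -/
@[simp] theorem ren_inv_ren (γ : Γ) (p : MvPolynomial X K) : ren γ⁻¹ (ren γ p) = p := by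
  rw [← ren_mul, inv_mul_cancel, ren_one]

/-- `ren γ` undoes `ren γ⁻¹`. [folklore] -/
@[simp] theorem ren_ren_inv (γ : Γ) (p : MvPolynomial X K) : ren γ (ren γ⁻¹ p) = p := by
  rw [← ren_mul, mul_inv_cancel, ren_one]

/-- `ren γ` is injective. [folklore] -/
theorem ren_injective (γ : Γ) : Function.Injective (ren (K := K) (X := X) γ) := fun p q h => by
  simpa using congrArg (ren γ⁻¹) h

end Ren

/-! ### Steps and value derivations -/

/-- **The data of one derivation step**: a variable, a constant, a weighted sum (any fan-in, with
multiplicity) of earlier values, or a binary product of earlier values. [folklore] -/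
inductive StepData (K : Type u) (X : Type v) [CommSemiring K] : Type (max u v)
  /-- The variable `x`. -/
  | var (x : X) : StepData K X
  /-- The constant `c`. -/
  | const (c : K) : StepData K X
  /-- The weighted sum `Σ_{(c,u) ∈ D} c · u`. -/
  | sum (D : Multiset (K × MvPolynomial X K)) : StepData K X
  /-- The product `u · v`. -/
  | prod (u v : MvPolynomial X K) : StepData K X

namespace StepData

variable {K : Type u} {X : Type v} [CommSemiring K]

/-- The value computed by a step. [folklore] -/
def value : StepData K X → MvPolynomial X K
  | var x => MvPolynomial.X x
  | const c => MvPolynomial.C c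
  | sum D => (D.map fun cu => MvPolynomial.C cu.1 * cu.2).sum
  | prod u v => u * v

/-- The operands of a step (with multiplicity). [folklore] -/
def args : StepData K X → Multiset (MvPolynomial X K)
  | var _ => 0
  | const _ => 0
  | sum D => D.map Prod.snd
  | prod u v => {u, v}

/-- A step is **valid** for `q` in `S` under the rank `r`: it computes `q` from operands that lie in
`S` and have smaller rank. [folklore] -/
structure Valid (S : Finset (MvPolynomial X K)) (r : MvPolynomial X K → ℕ) (q : MvPolynomial X K)
    (d : StepData K X) : Prop where
  /-- The step computes `q`. -/
  value_eq : d.value = q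
  /-- The operands are values of smaller rank. -/
  args_lt : ∀ u ∈ d.args, u ∈ S ∧ r u < r q

variable {Γ : Type w} [Group Γ] [MulAction Γ X]

/-- Transport of a step along a symmetry of the variables. [folklore] -/
def map (γ : Γ) : StepData K X → StepData K X
  | var x => var (γ • x)
  | const c => const c
  | sum D => sum (D.map fun cu => (cu.1, ren γ cu.2))
  | prod u v => prod (ren γ u) (ren γ v)

/-- The transported step computes the renamed value. [folklore] -/
theorem value_map (γ : Γ) (d : StepData K X) : (d.map γ).value = ren γ d.value := by
  cases d with
  | var x => simp [map, value]
  | const c => simp [map, value]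
  | sum D => simp [map, value, Multiset.map_map, map_multiset_sum]
  | prod u v => simp [map, value]

/-- The operands of the transported step are the renamed operands. [folklore] -/
theorem args_map (γ : Γ) (d : StepData K X) : (d.map γ).args = d.args.map (ren γ) := by
  cases d with
  | var x => simp [map, args]
  | const c => simp [map, args]
  | sum D => simp [map, args, Multiset.map_map]
  | prod u v => simp [map, args]

/-- Transport is an action: `map (δ * γ) = map δ ∘ map γ`. [folklore] -/
theorem map_mul (δ γ : Γ) (d : StepData K X) : d.map (δ * γ) = (d.map γ).map δ := by
  cases d with
  | var x => simp [map, mul_smul]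
  | const c => simp [map]
  | sum D => simp [map, Multiset.map_map, ren_mul]
  | prod u v => simp [map, ren_mul]

end StepData

/-- **A value derivation**: a finite set `S` of polynomials with a rank function such that every member
is derived by a valid step (variable, constant, weighted sum or binary product of members of smaller
rank) — the set of intermediate VALUES of an ordinary straight-line computation, of any length.
[folklore] -/
structure ValueDerivation (K : Type u) (X : Type v) [CommSemiring K] where
  /-- The values. -/
  S : Finset (MvPolynomial X K)
  /-- The rank (position in the computation). -/
  rank : MvPolynomial X K → ℕ
  /-- Every value is derived by a valid step. -/
  step : ∀ q ∈ S, ∃ d : StepData K X, d.Valid S rank q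

namespace ValueDerivation

variable {K : Type u} {X : Type v} [Field K] (𝒟 : ValueDerivation K X)
variable {Γ : Type w} [Group Γ] [Fintype Γ] [MulAction Γ X]

/-! ### Closing under `Γ`: the values `U = Γ • S`, least-rank witnesses -/

variable (Γ) in
/-- The `Γ`-closure of the values. [folklore] -/
def U : Finset (MvPolynomial X K) :=
  (Finset.univ ×ˢ 𝒟.S).image fun w : Γ × MvPolynomial X K => ren w.1 w.2

variable (Γ) in
omit [Fintype Γ] in
/-- The rank on `U`: the least rank of a witness `(γ, p)`, `p ∈ S`, `γ • p = q` (junk `0` off `U`).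
[folklore] -/
def rU (q : MvPolynomial X K) : ℕ :=
  sInf {k : ℕ | ∃ γ : Γ, ∃ p ∈ 𝒟.S, ren γ p = q ∧ 𝒟.rank p = k}

variable (Γ) in
/-- The least-rank witnesses of `q`. [folklore] -/
def W (q : MvPolynomial X K) : Finset (Γ × MvPolynomial X K) :=
  (Finset.univ ×ˢ 𝒟.S).filter fun w => ren w.1 w.2 = q ∧ 𝒟.rank w.2 = 𝒟.rU Γ q

/-- Membership in `U`. [folklore] -/
theorem mem_U {q : MvPolynomial X K} : q ∈ 𝒟.U Γ ↔ ∃ γ : Γ, ∃ p ∈ 𝒟.S, ren γ p = q := by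
  simp only [U, Finset.mem_image, Finset.mem_product, Finset.mem_univ, true_and, Prod.exists]

/-- `S ⊆ U`. [folklore] -/
theorem mem_U_of_mem_S {q : MvPolynomial X K} (hq : q ∈ 𝒟.S) : q ∈ 𝒟.U Γ :=
  𝒟.mem_U.2 ⟨1, q, hq, ren_one q⟩

/-- `U` is `Γ`-stable. [folklore] -/
theorem ren_mem_U (δ : Γ) {q : MvPolynomial X K} (hq : q ∈ 𝒟.U Γ) : ren δ q ∈ 𝒟.U Γ := by
  obtain ⟨γ, p, hp, rfl⟩ := 𝒟.mem_U.1 hq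
  exact 𝒟.mem_U.2 ⟨δ * γ, p, hp, ren_mul δ γ p⟩

/-- `U` is `Γ`-stable (iff form). [folklore] -/
theorem ren_mem_U_iff (δ : Γ) {q : MvPolynomial X K} : ren δ q ∈ 𝒟.U Γ ↔ q ∈ 𝒟.U Γ :=
  ⟨fun h => by simpa using 𝒟.ren_mem_U δ⁻¹ h, 𝒟.ren_mem_U δ⟩

omit [Fintype Γ] in
/-- The rank of a witness bounds `rU`. [folklore] -/
theorem rU_le {q p : MvPolynomial X K} {γ : Γ} (hp : p ∈ 𝒟.S) (h : ren γ p = q) : 𝒟.rU Γ q ≤ 𝒟.rank p :=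
  Nat.sInf_le ⟨γ, p, hp, h, rfl⟩

/-- A member of `U` has a least-rank witness. [folklore] -/
theorem exists_witness {q : MvPolynomial X K} (hq : q ∈ 𝒟.U Γ) :
    ∃ γ : Γ, ∃ p ∈ 𝒟.S, ren γ p = q ∧ 𝒟.rank p = 𝒟.rU Γ q := by
  obtain ⟨γ, p, hp, h⟩ := 𝒟.mem_U.1 hq
  have hne : {k : ℕ | ∃ γ : Γ, ∃ p ∈ 𝒟.S, ren γ p = q ∧ 𝒟.rank p = k}.Nonempty := ⟨_, γ, p, hp, h, rfl⟩
  exact Nat.sInf_mem hne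

omit [Fintype Γ] in
/-- `rU` is `Γ`-invariant. [folklore] -/
theorem rU_ren (δ : Γ) (q : MvPolynomial X K) : 𝒟.rU Γ (ren δ q) = 𝒟.rU Γ q := by
  unfold rU
  congr 1
  ext k
  constructor
  · rintro ⟨γ, p, hp, h, hk⟩
    refine ⟨δ⁻¹ * γ, p, hp, ?_, hk⟩
    rw [ren_mul, h, ren_inv_ren]
  · rintro ⟨γ, p, hp, h, hk⟩
    exact ⟨δ * γ, p, hp, by rw [ren_mul, h], hk⟩

/-- Membership in `W q`. [folklore] -/
theorem mem_W {q : MvPolynomial X K} {w : Γ × MvPolynomial X K} :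
    w ∈ 𝒟.W Γ q ↔ w.2 ∈ 𝒟.S ∧ ren w.1 w.2 = q ∧ 𝒟.rank w.2 = 𝒟.rU Γ q := by
  simp [W]

/-- `W q` is nonempty for `q ∈ U`. [folklore] -/
theorem W_nonempty {q : MvPolynomial X K} (hq : q ∈ 𝒟.U Γ) : (𝒟.W Γ q).Nonempty := by
  obtain ⟨γ, p, hp, h, hr⟩ := 𝒟.exists_witness hq
  exact ⟨(γ, p), 𝒟.mem_W.2 ⟨hp, h, hr⟩⟩

/-- The witnesses of `δ • q` are the translates of the witnesses of `q`. [folklore] -/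
theorem W_ren (δ : Γ) (q : MvPolynomial X K) :
    𝒟.W Γ (ren δ q) = (𝒟.W Γ q).map ⟨fun w => (δ * w.1, w.2),
      fun w w' h => by
        simp only [Prod.mk.injEq, mul_right_inj] at h
        exact Prod.ext h.1 h.2⟩ := by
  ext ⟨γ, p⟩
  simp only [mem_W, rU_ren, Finset.mem_map, Function.Embedding.coeFn_mk, Prod.mk.injEq, Prod.exists]
  constructor
  · rintro ⟨hp, h, hr⟩
    refine ⟨δ⁻¹ * γ, p, ⟨hp, ?_, hr⟩, by group, rfl⟩
    rw [ren_mul, h, ren_inv_ren]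
  · rintro ⟨γ', p', ⟨hp', h', hr'⟩, rfl, rfl⟩
    exact ⟨hp', by rw [ren_mul, h'], hr'⟩

/-- The cardinality of `W` is `Γ`-invariant. [folklore] -/
theorem card_W_ren (δ : Γ) (q : MvPolynomial X K) : (𝒟.W Γ (ren δ q)).card = (𝒟.W Γ q).card := by
  rw [W_ren, Finset.card_map]

/-! ### The chosen steps -/

/-- A chosen valid step for each value (junk off `S`). [folklore] -/
def stepOf (p : MvPolynomial X K) : StepData K X :=
  if h : p ∈ 𝒟.S then (𝒟.step p h).choose else StepData.const 0

/-- The chosen step is valid. [folklore] -/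
theorem stepOf_valid {p : MvPolynomial X K} (hp : p ∈ 𝒟.S) : (𝒟.stepOf p).Valid 𝒟.S 𝒟.rank p := by
  rw [stepOf, dif_pos hp]
  exact (𝒟.step p hp).choose_spec

/-- The transported step of a least-rank witness of `q` computes `q`. [folklore] -/
theorem value_step_W {q : MvPolynomial X K} {w : Γ × MvPolynomial X K} (hw : w ∈ 𝒟.W Γ q) :
    ((𝒟.stepOf w.2).map w.1).value = q := by
  obtain ⟨hp, h, _⟩ := 𝒟.mem_W.1 hw
  rw [StepData.value_map, (𝒟.stepOf_valid hp).value_eq, h]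

/-- The operands of the transported step of a least-rank witness of `q` lie in `U` with smaller `rU`.
[folklore] -/
theorem args_step_W {q : MvPolynomial X K} {w : Γ × MvPolynomial X K} (hw : w ∈ 𝒟.W Γ q)
    {u : MvPolynomial X K} (hu : u ∈ ((𝒟.stepOf w.2).map w.1).args) :
    u ∈ 𝒟.U Γ ∧ 𝒟.rU Γ u < 𝒟.rU Γ q := by
  obtain ⟨hp, _, hr⟩ := 𝒟.mem_W.1 hw
  rw [StepData.args_map, Multiset.mem_map] at hu
  obtain ⟨u', hu', rfl⟩ := hu
  obtain ⟨hu'S, hlt⟩ := (𝒟.stepOf_valid hp).args_lt u' hu'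
  exact ⟨𝒟.mem_U.2 ⟨w.1, u', hu'S, rfl⟩, (𝒟.rU_le hu'S rfl).trans_lt (hr ▸ hlt)⟩

end ValueDerivation

end Summit.ValiantsHypothesis.ValiantsHypothesis.Theorems

end
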